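import Summits.HodgeConjecture.HodgeConjecture.Theorems.F0P3cStCharTSKappaRatio      -- ★ p850245 (LH6-p02 (g2)) `hAH_of_closed_forms`, `hAG_of_closed_forms'`, `measureReal_prod_coe_prod_top`, `map_cmDatumLocalCongr_one_symm_real`
import Summits.HodgeConjecture.HodgeConjecture.Theorems.F0P3cStCharTSHcard           -- ★ p850359 (LH5-p01 (g2)) «HCARD» `hcard`, `hrH`; brings ★ HAAR-PSI `exists_torusIso`, ★ CONSTANTS `ofReal_measureReal_coe_subgroup_ne_zero`
import Literature.NumberTheory.Automorphic.CMTorusRegularAEPrelims                   -- ★ `isClosed_torusU_of_t1Space` (`T_N` closed in `U(Φ_N)(L⁺_v)`)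
import Literature.NumberTheory.Automorphic.CMBorelWeylTorusConjugateTwo              -- ★ `weylConj_mem_cmTorus_two` (the flipped torus point `b_u = ʷu₁`)
import HarnessLib

/-!
# F0 · P3c · line LH6 «StCharTS» — road (D) «DEEP-FL», (D-c)(δ₄) «VALUE RATIOS»: the four measure-side inputs `hAG ∕ hAH ∕ hrH ∕ hcard` of the VALUE conjunct,
# at the head's closed-form letters, as ONE existential — `∃ r_G r_H, κ_G·1 = A_G·r_G ∧ (∀ u ∈ F, κ_{H,u} = A_u·r_H) ∧ r_H ≠ 0 ∧ |F|·r_G = r_H`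
# [Rogawski1990, §12.7 L. 12.7.3 (proof) p. 195; §4.9 Lemma 4.9.2 p. 56] [DeitmarEchterhoff2014, Thm. 1.5.3] [HewittRoss1979, (15.8)]

Cell `pub/hodgecm-mathlib`, crux H413 = `stmt-HodgeConjecture-24833` (lane `--supports … --as helper`), route HCCMUnconditional; seat LH6-p02 (g3) (VALUE lineage:
★ p849817, ★ p850018, ★ p850245 KAPPA-RATIO, ★ p850420 VALUE-AT-FLIPS; constants sheet `F0/P3b/LH6-p02/g2/KAPPA-RATIO.sheet.v1.md` c7274337 §1 (A)(KH)(RH)(KG)(AG)(RG)(CNT)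
= letters of record, owner LH6-p04 (g3) 07:32:36Z).  Consumer: the (D-c) HEAD «XIG-ASSEMBLY» CHECKPOINT 3 (`case value`): `obtain ⟨rG, rH, hAG, hAH, hrH, hcard⟩ :=
exists_value_ratios …; exact ★ VALUE-AT-FLIPS … hval hAH hAG hrH hcard htr`.  THEOREMS ONLY, sorry-free, ★-only imports; no definition ∕ instance ∕ notation ∕ named
fact.  HONEST LABEL: HC_CM is proved only modulo the 7 printed citations (2 remaining: hLiu418 = stmt-HodgeConjecture-24832, h413 = stmt-HodgeConjecture-24833) until
rung 0 closes; count-neutral.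

THE LETTERS (all VERBATIM from their ★ producers; `T₃ = ↥(cmBorelTriple L 3 v).M`, `T₂ = ↥(cmBorelTriple L 2 v).M`, `X_H = T₂ × U(Φ₁)_v`, `b_u := ʷu₁ = w₂ u₁ w₂⁻¹`):
* `κ_G := (((ν_Q ∘ e₁⁻¹)(K_n) · #R · δ₃) · μ_T{t : ↑t ∈ K_{3,v}}) ∕ μ_T(S_n)` — ★ HOG-OF-GVALUE p850178 as instantiated in the owner's head v3c :236 (`μ_T` any Haar measure on `T₃`;
  the head takes `Measure.haar`), `κ := 1`;  `A_G := ν_Q(K_n) · #R · δ₃` — the XIG′ prefix;  `(ν_Q ∘ e₁⁻¹)(K_n) = ν_Q(K_n)` is ★ `map_cmDatumLocalCongr_one_symm_real`.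
* `κ_{H,u} := (ν_H(K_{2,n′} × ⊤) · #R₂(u) · δ₂(b_u) · μ_{T₂}{t : ↑t ∈ K_{2,v}}) ∕ μ_{T₂}(T₂ ∩ K_{2,n′})` — ★ HSHELL-GLUE p850340 `hOHj_xig_of_hF1H`'s constant (`κ′ := 1`);
  `A_u := ν₂(K_{2,n′}) · #R₂(u) · ν₁(K₁) · δ₂(b_u)` — ★ HTR-AT-REPS p850360's prefix;  `ν_H(K_{2,n′} × ⊤) = ν₂(K_{2,n′})·ν₁(univ)` for `ν₂ ⊗ ν₁ = ν_H` (★ HAAR-PROD-SPLIT p850050,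
  ★ `measureReal_prod_coe_prod_top`).
* `r_G := μ_T{K_{3,v}} ∕ μ_T(S_n)`, `r_H := ν₁(univ)·μ_{T₂}{K_{2,v}} ∕ (ν₁(K₁)·μ_{T₂}(C₂))`, `C₂ := T₂ ∩ K_{2,n′}` — ★ HCARD's letters; `|F|·r_G = r_H`, `r_H ≠ 0` are ★ HCARD
  `hcard` ∕ `hrH` over the XIG-DATA cover (`hcover`, `hdisj` BY SHAPE = ★ `exists_xigData` conjuncts (c)③, (c)②), the torus isomorphism `Ψ_T` being OBTAINED here
  (★ HAAR-PSI `exists_torusIso`), not a binder; `S_n`, `C₂` compact open from `S_n = K_n ∩ T₃` and ★ `isClosed_torusU_of_t1Space`.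

* §1 **`exists_value_ratios`** — the four inputs at once.

## References
* [Rogawski1990] J. D. Rogawski, *Automorphic Representations of Unitary Groups in Three Variables*, Ann. of Math. Stud. 123 (1990): §4.9 Lemma 4.9.2 p. 56; §12.7
  Lemma 12.7.3 (proof) p. 195.
* [DeitmarEchterhoff2014] A. Deitmar, S. Echterhoff, *Principles of Harmonic Analysis*, 2nd ed. (2014), Thm. 1.5.3 (uniqueness of Haar measure).
* [HewittRoss1979] E. Hewitt, K. A. Ross, *Abstract Harmonic Analysis I*, 2nd ed. (1979), (15.8) (Haar measure is positive on non-empty open sets).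
-/

set_option autoImplicit false
-- the mandated namespace has the single-problem summit's repeated segment (`HodgeConjecture.HodgeConjecture`)
set_option linter.dupNamespace false

noncomputable section

open NumberField IsDedekindDomain MeasureTheory Topology
open scoped Matrix MatrixGroups Pointwise
open Literature.NumberTheory Literature.NumberTheory.Automorphic Literature.NumberTheory.Automorphic.UnitaryGroup
open Literature.NumberTheory.GaloisRepresentations
open Literature.NumberTheory.Rogawski1990

namespace Summit.HodgeConjecture.HodgeConjecture.Cruxes.H413.F0P3cStCharTSValueRatios

variable (L : Type) [Field L] [NumberField L] [IsCMField L] (v : HeightOneSpectrum (𝓞 ↥(maximalRealSubfield L)))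

set_option maxHeartbeats 4000000 in  -- cross-spelling statement-level `whnf` on the CM carriers (measured class, as ★ HCARD ∕ ★ HTR-AT-REPS)
set_option synthInstance.maxHeartbeats 400000 in
/-- **«VALUE RATIOS».**  At a finite place `v` of `L⁺` non-split in `L` (the conjugation-fixed place `w ∣ v`), for Haar measures `ν₂ ⊗ ν₁ = ν_H` on `H_v = U(Φ₂)_v × U(Φ₁)_v` (★ HAAR-PROD-SPLIT),
any measure `ν_Q` on `U(Φ₃)(L⁺_v)` (two names of one σ-algebra, as in ★ `map_cmDatumLocalCongr_one_symm_real`), Haar measures `μ_T`, `μ_{T₂}` on the tori `T₃`, `T₂`,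
the G-shell data `(𝓘, n, S_n = K_n ∩ T₃, b′)`, the H-shell level `K_H = K_{2,n′} × K₁` with `S′ = (T₂ ∩ K_{2,n′}) × K₁`, and the XIG-DATA cover `F` of `Ψ₀⁻¹(b′·S_n)`
by the cosets `u·S′` (`hcover`, `hdisj`): there are `r_G, r_H ∈ ℂ` with **`κ_G·1 = A_G·r_G`**, **`κ_{H,u} = A_u·r_H` for every `u ∈ F`**, **`r_H ≠ 0`** and **`|F|·r_G = r_H`**
in the letters of the file header — exactly the `hAG ∕ hAH ∕ hrH ∕ hcard` binders of ★ VALUE-AT-FLIPS p850420 `smoothTrace_fH0_eq_mul_cmXiTorusChar(_of_oriented)`.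
Proof: ★ `hAG_of_closed_forms'` ∘ ★ `map_cmDatumLocalCongr_one_symm_real`; ★ `hAH_of_closed_forms` ∘ ★ `measureReal_prod_coe_prod_top` (Haar positivity of `ν₁(K₁)`,
`μ_{T₂}(C₂)`: ★ CONSTANTS); ★ HCARD `hrH`, `hcard` over ★ `exists_torusIso`.
[cite: Rogawski1990, §12.7 Lemma 12.7.3 (proof) p. 195; §4.9 Lemma 4.9.2 p. 56] [cite: DeitmarEchterhoff2014, Thm. 1.5.3] [cite: HewittRoss1979, (15.8)] -/
theorem exists_value_ratios
    (w : PlacesOver L v) (hw : IsCMField.complexConj L • w.1 = w.1)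
    -- σ-algebras: the two factors of `H_v` (★ HAAR-PROD-SPLIT ∕ ★ HTR-AT-REPS spelling), `U(Φ₂)` once more in the subgroup spelling (★ HCARD ∕ ★ HSHELL-GLUE's `μ_T`),
    -- and `U(Φ₃)(L⁺_v)` under its two names (★ `map_cmDatumLocalCongr_one_symm_real`)
    [MeasurableSpace ((cmDatum L 2 (Matrix.of fun i j : Fin 2 => if i.val + j.val + 1 = 2 then (1 : L) else 0)).Local v)]
    [BorelSpace ((cmDatum L 2 (Matrix.of fun i j : Fin 2 => if i.val + j.val + 1 = 2 then (1 : L) else 0)).Local v)]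
    [MeasurableSpace ↥(unitaryGroupOfForm (conjLocal L (IsCMField.complexConj L) v) (cmLocalForm L 2 v))]
    [BorelSpace ↥(unitaryGroupOfForm (conjLocal L (IsCMField.complexConj L) v) (cmLocalForm L 2 v))]
    [MeasurableSpace ((cmDatum L 1 (Matrix.of fun i j : Fin 1 => if i.val + j.val + 1 = 1 then (1 : L) else 0)).Local v)]
    [BorelSpace ((cmDatum L 1 (Matrix.of fun i j : Fin 1 => if i.val + j.val + 1 = 1 then (1 : L) else 0)).Local v)]
    [MeasurableSpace ((cmDatum L 3 (qsForm L)).Local v)] [BorelSpace ((cmDatum L 3 (qsForm L)).Local v)]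
    [MeasurableSpace ↥(unitaryGroupOfForm (conjLocal L (IsCMField.complexConj L) v) (cmLocalForm L 3 v))]
    [BorelSpace ↥(unitaryGroupOfForm (conjLocal L (IsCMField.complexConj L) v) (cmLocalForm L 3 v))]
    -- the measures
    (νH : Measure (((cmDatum L 2 (Matrix.of fun i j : Fin 2 => if i.val + j.val + 1 = 2 then (1 : L) else 0)).Local v) ×
      ((cmDatum L 1 (Matrix.of fun i j : Fin 1 => if i.val + j.val + 1 = 1 then (1 : L) else 0)).Local v)))
    (ν₂ : Measure ((cmDatum L 2 (Matrix.of fun i j : Fin 2 => if i.val + j.val + 1 = 2 then (1 : L) else 0)).Local v)) [ν₂.IsHaarMeasure]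
    (ν₁ : Measure ((cmDatum L 1 (Matrix.of fun i j : Fin 1 => if i.val + j.val + 1 = 1 then (1 : L) else 0)).Local v)) [ν₁.IsHaarMeasure]
    (hprod : ν₂.prod ν₁ = νH)
    (νQv : Measure ((cmDatum L 3 (qsForm L)).Local v))
    (μT : Measure ↥(cmBorelTriple L 3 v).M) [μT.IsHaarMeasure] (μT₂ : Measure ↥(cmBorelTriple L 2 v).M) [μT₂.IsHaarMeasure]
    -- the G-shell data: the Iwahori datum, the level `n`, the shell group `S_n = K_n ∩ T₃`, the base `b′`, the transversal `R`, the modulus value `δ₃`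
    (𝓘 : (cmBorelTriple L 3 v).IwahoriDatum) (n : ℕ)
    (Sn : Subgroup ↥(cmBorelTriple L 3 v).M) (hSn : Sn = (𝓘.K n).subgroupOf (cmBorelTriple L 3 v).M) (b' : ↥(cmBorelTriple L 3 v).M)
    (R : Finset ↥(unitaryGroupOfForm (conjLocal L (IsCMField.complexConj L) v) (cmLocalForm L 3 v))) (δ₃ : ℂ)
    -- the H-shell level `K_H = K_{2,n′} × K₁`, the H-Weyl element `w₂`, the transversals `R₂ u`
    (𝓘₂ : (cmBorelTriple L 2 v).IwahoriDatum) (n' : ℕ)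
    (K₁ : Subgroup ((cmDatum L 1 (Matrix.of fun i j : Fin 1 => if i.val + j.val + 1 = 1 then (1 : L) else 0)).Local v))
    (hK₁o : IsOpen (K₁ : Set ((cmDatum L 1 (Matrix.of fun i j : Fin 1 => if i.val + j.val + 1 = 1 then (1 : L) else 0)).Local v)))
    (hK₁c : IsCompact (K₁ : Set ((cmDatum L 1 (Matrix.of fun i j : Fin 1 => if i.val + j.val + 1 = 1 then (1 : L) else 0)).Local v)))
    (w₂ : ↥(unitaryGroupOfForm (conjLocal L (IsCMField.complexConj L) v) (cmLocalForm L 2 v)))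
    (hw₂ : Units.val (w₂ : GL (Fin 2) (LocalRing L v)) = cmLocalForm L 2 v)
    (R₂ : ↥(cmBorelTriple L 2 v).M × ((cmDatum L 1 (Matrix.of fun i j : Fin 1 => if i.val + j.val + 1 = 1 then (1 : L) else 0)).Local v) →
      Finset ↥(unitaryGroupOfForm (conjLocal L (IsCMField.complexConj L) v) (cmLocalForm L 2 v)))
    -- the XIG-DATA cover of `Ψ₀⁻¹(b′·S_n)` by the cosets `u · S′`, `S′ = (T₂ ∩ K_{2,n′}) × K₁` (★ `exists_xigData` (c)③, (c)② verbatim)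
    (F : Finset (↥(cmBorelTriple L 2 v).M × ((cmDatum L 1 (Matrix.of fun i j : Fin 1 => if i.val + j.val + 1 = 1 then (1 : L) else 0)).Local v)))
    (hcover : (fun x : ↥(cmBorelTriple L 2 v).M ×
          (cmDatum L 1 (Matrix.of fun i j : Fin 1 => if i.val + j.val + 1 = 1 then (1 : L) else 0)).Local v =>
        endoEmbLocal L v ((x.1 : ↥(unitaryGroupOfForm (conjLocal L (IsCMField.complexConj L) v) (cmLocalForm L 2 v))), x.2)) ⁻¹'
          (Subtype.val '' (b' • (Sn : Set ↥(cmBorelTriple L 3 v).M))) =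
        ⋃ u ∈ F, u • ((((𝓘₂.K n').comap (cmBorelTriple L 2 v).M.subtype).prod K₁ :
            Subgroup (↥(cmBorelTriple L 2 v).M × (cmDatum L 1 (Matrix.of fun i j : Fin 1 => if i.val + j.val + 1 = 1 then (1 : L) else 0)).Local v)) :
          Set (↥(cmBorelTriple L 2 v).M × (cmDatum L 1 (Matrix.of fun i j : Fin 1 => if i.val + j.val + 1 = 1 then (1 : L) else 0)).Local v)))
    (hdisj : (↑F : Set (↥(cmBorelTriple L 2 v).M ×
        (cmDatum L 1 (Matrix.of fun i j : Fin 1 => if i.val + j.val + 1 = 1 then (1 : L) else 0)).Local v)).PairwiseDisjoint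
          (fun u => u • ((((𝓘₂.K n').comap (cmBorelTriple L 2 v).M.subtype).prod K₁ :
            Subgroup (↥(cmBorelTriple L 2 v).M × (cmDatum L 1 (Matrix.of fun i j : Fin 1 => if i.val + j.val + 1 = 1 then (1 : L) else 0)).Local v)) :
          Set (↥(cmBorelTriple L 2 v).M × (cmDatum L 1 (Matrix.of fun i j : Fin 1 => if i.val + j.val + 1 = 1 then (1 : L) else 0)).Local v)))) :
    haveI := locallyCompactSpace_cmBorelU L 2 v
    ∃ rG rH : ℂ,
      -- (hAG) `κ_G · 1 = A_G · r_G` — `κ_G` of the head (v3c :236) VERBATIM over `μ_T`, `A_G` = the XIG′ prefix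
      ((((νQv.map (cmDatumLocalCongr L v (1 : GL (Fin 3) (LocalRing L v)) isUnit_one (F0P3cStCharTSDeltaAtLevi.formCongr_one_qsForm L v)).symm :
            Measure ↥(unitaryGroupOfForm (conjLocal L (IsCMField.complexConj L) v) (cmLocalForm L 3 v))).real
              ((𝓘.K n) : Set ↥(unitaryGroupOfForm (conjLocal L (IsCMField.complexConj L) v) (cmLocalForm L 3 v))) : ℂ) * (R.card : ℂ) * δ₃) *
          ((μT.real {t : ↥(cmBorelTriple L 3 v).M | (t : ↥(unitaryGroupOfForm (conjLocal L (IsCMField.complexConj L) v) (cmLocalForm L 3 v))) ∈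
            cmLocalIntegralLevel L 3 (Matrix.of fun i j : Fin 3 => if i.val + j.val + 1 = 3 then (1 : L) else 0) v} : ℝ) : ℂ) /
          ((μT.real (Sn : Set ↥(cmBorelTriple L 3 v).M) : ℝ) : ℂ) * 1 =
        (νQv.real ((𝓘.K n) : Set ↥(unitaryGroupOfForm (conjLocal L (IsCMField.complexConj L) v) (cmLocalForm L 3 v))) : ℂ) * (R.card : ℂ) * δ₃ * rG) ∧
      -- (hAH) `κ_{H,u} = A_u · r_H` — `κ_{H,u}` = ★ HSHELL-GLUE's constant VERBATIM (at `ν_H`, `μ_{T₂}`, `n′`, `w₂`), `A_u` = ★ HTR-AT-REPS' prefix VERBATIM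
      (∀ u ∈ F,
        (((νH.real ((((𝓘₂.K n').prod (⊤ : Subgroup ((cmDatum L 1 (Matrix.of fun i j : Fin 1 => if i.val + j.val + 1 = 1 then (1 : L) else 0)).Local v))) :
            Subgroup (↥(unitaryGroupOfForm (conjLocal L (IsCMField.complexConj L) v) (cmLocalForm L 2 v)) ×
              ((cmDatum L 1 (Matrix.of fun i j : Fin 1 => if i.val + j.val + 1 = 1 then (1 : L) else 0)).Local v))) :
            Set (↥(unitaryGroupOfForm (conjLocal L (IsCMField.complexConj L) v) (cmLocalForm L 2 v)) ×
              ((cmDatum L 1 (Matrix.of fun i j : Fin 1 => if i.val + j.val + 1 = 1 then (1 : L) else 0)).Local v)))) : ℝ) : ℂ) * ((R₂ u).card : ℂ) *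
            (((rootDeltaChar (cmBorelTriple L 2 v).P (Subgroup.inclusion (cmBorelTriple L 2 v).M_le
              ⟨(w₂ * (u.1 : ↥(unitaryGroupOfForm (conjLocal L (IsCMField.complexConj L) v) (cmLocalForm L 2 v))) * w₂⁻¹), (weylConj_mem_cmTorus_two L v w₂ hw₂ u.1)⟩)) : ℂˣ) : ℂ) *
            ((μT₂.real {t : ↥(cmBorelTriple L 2 v).M | (t : ↥(unitaryGroupOfForm (conjLocal L (IsCMField.complexConj L) v) (cmLocalForm L 2 v))) ∈
              cmLocalIntegralLevel L 2 (Matrix.of fun i j : Fin 2 => if i.val + j.val + 1 = 2 then (1 : L) else 0) v} : ℝ) : ℂ) /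
            ((μT₂.real ((((𝓘₂.K n').comap (cmBorelTriple L 2 v).M.subtype : Subgroup ↥(cmBorelTriple L 2 v).M)) : Set ↥(cmBorelTriple L 2 v).M) : ℝ) : ℂ) =
          (ν₂.real (𝓘₂.K n' : Set ↥(unitaryGroupOfForm (conjLocal L (IsCMField.complexConj L) v) (cmLocalForm L 2 v))) : ℂ) * ((R₂ u).card : ℂ) *
              (ν₁.real (K₁ : Set ((cmDatum L 1 (Matrix.of fun i j : Fin 1 => if i.val + j.val + 1 = 1 then (1 : L) else 0)).Local v)) : ℂ) *
              (((rootDeltaChar (cmBorelTriple L 2 v).P (Subgroup.inclusion (cmBorelTriple L 2 v).M_le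
                ⟨(w₂ * (u.1 : ↥(unitaryGroupOfForm (conjLocal L (IsCMField.complexConj L) v) (cmLocalForm L 2 v))) * w₂⁻¹), (weylConj_mem_cmTorus_two L v w₂ hw₂ u.1)⟩)) : ℂˣ) : ℂ) *
            rH) ∧
      -- (hrH), (hcard)
      rH ≠ 0 ∧ (F.card : ℂ) * rG = rH := by
  haveI := locallyCompactSpace_cmBorelU L 2 v
  haveI : SecondCountableTopology ((cmDatum L 1 (Matrix.of fun i j : Fin 1 => if i.val + j.val + 1 = 1 then (1 : L) else 0)).Local v) :=
    secondCountableTopology_local (IsCMField.complexConj L) 1 _ v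
  -- the torus isomorphism `Ψ_T` (★ HAAR-PSI) and the topology of `S_n`, `C₂ := T₂ ∩ K_{2,n′}`
  obtain ⟨Ψ, hΨ⟩ := F0P3cStCharTSHaarPsi.exists_torusIso L v
  have hSno : IsOpen (Sn : Set ↥(cmBorelTriple L 3 v).M) := by
    rw [hSn]; exact (𝓘.isOpen_K n).preimage continuous_subtype_val
  have hSnc : IsCompact (Sn : Set ↥(cmBorelTriple L 3 v).M) := by
    rw [hSn]
    exact (isClosed_torusU_of_t1Space (conjLocal L (IsCMField.complexConj L) v) (cmLocalForm L 3 v)).isClosedEmbedding_subtypeVal.isCompact_preimage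
      (𝓘.isCompact_K n)
  have hC₂o : IsOpen ((((𝓘₂.K n').comap (cmBorelTriple L 2 v).M.subtype : Subgroup ↥(cmBorelTriple L 2 v).M)) : Set ↥(cmBorelTriple L 2 v).M) :=
    (𝓘₂.isOpen_K n').preimage continuous_subtype_val
  have hC₂c : IsCompact ((((𝓘₂.K n').comap (cmBorelTriple L 2 v).M.subtype : Subgroup ↥(cmBorelTriple L 2 v).M)) : Set ↥(cmBorelTriple L 2 v).M) :=
    (isClosed_torusU_of_t1Space (conjLocal L (IsCMField.complexConj L) v) (cmLocalForm L 2 v)).isClosedEmbedding_subtypeVal.isCompact_preimage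
      (𝓘₂.isCompact_K n')
  -- the two scalar bridges: `(ν_Q ∘ e₁⁻¹)(K_n) = ν_Q(K_n)` and `ν_H(K_{2,n′} × ⊤) = ν₂(K_{2,n′}) · ν₁(univ)`
  have hN : ((νQv.map (cmDatumLocalCongr L v (1 : GL (Fin 3) (LocalRing L v)) isUnit_one (F0P3cStCharTSDeltaAtLevi.formCongr_one_qsForm L v)).symm :
            Measure ↥(unitaryGroupOfForm (conjLocal L (IsCMField.complexConj L) v) (cmLocalForm L 3 v))).real
              ((𝓘.K n) : Set ↥(unitaryGroupOfForm (conjLocal L (IsCMField.complexConj L) v) (cmLocalForm L 3 v))) : ℂ) =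
      (νQv.real ((𝓘.K n) : Set ↥(unitaryGroupOfForm (conjLocal L (IsCMField.complexConj L) v) (cmLocalForm L 3 v))) : ℂ) := by
    rw [F0P3cStCharTSKappaRatio.map_cmDatumLocalCongr_one_symm_real L v νQv _ (𝓘.isOpen_K n).measurableSet]
  have hNK : (((νH.real ((((𝓘₂.K n').prod (⊤ : Subgroup ((cmDatum L 1 (Matrix.of fun i j : Fin 1 => if i.val + j.val + 1 = 1 then (1 : L) else 0)).Local v))) :
            Subgroup (↥(unitaryGroupOfForm (conjLocal L (IsCMField.complexConj L) v) (cmLocalForm L 2 v)) ×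
              ((cmDatum L 1 (Matrix.of fun i j : Fin 1 => if i.val + j.val + 1 = 1 then (1 : L) else 0)).Local v))) :
            Set (↥(unitaryGroupOfForm (conjLocal L (IsCMField.complexConj L) v) (cmLocalForm L 2 v)) ×
              ((cmDatum L 1 (Matrix.of fun i j : Fin 1 => if i.val + j.val + 1 = 1 then (1 : L) else 0)).Local v)))) : ℝ) : ℂ) =
      (ν₂.real (𝓘₂.K n' : Set ↥(unitaryGroupOfForm (conjLocal L (IsCMField.complexConj L) v) (cmLocalForm L 2 v))) : ℂ) *
        ((ν₁.real (Set.univ : Set ((cmDatum L 1 (Matrix.of fun i j : Fin 1 => if i.val + j.val + 1 = 1 then (1 : L) else 0)).Local v)) : ℝ) : ℂ) := by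
    have h := F0P3cStCharTSKappaRatio.measureReal_prod_coe_prod_top ν₂ ν₁ (𝓘₂.K n')
    rw [hprod] at h
    rw [← Complex.ofReal_mul]
    exact congrArg _ h
  refine ⟨((μT.real {t : ↥(cmBorelTriple L 3 v).M | (t : ↥(unitaryGroupOfForm (conjLocal L (IsCMField.complexConj L) v) (cmLocalForm L 3 v))) ∈
              cmLocalIntegralLevel L 3 (Matrix.of fun i j : Fin 3 => if i.val + j.val + 1 = 3 then (1 : L) else 0) v} : ℝ) : ℂ) /
            ((μT.real (Sn : Set ↥(cmBorelTriple L 3 v).M) : ℝ) : ℂ),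
          ((ν₁.real (Set.univ : Set ((cmDatum L 1 (Matrix.of fun i j : Fin 1 => if i.val + j.val + 1 = 1 then (1 : L) else 0)).Local v)) : ℝ) : ℂ) *
            ((μT₂.real {t : ↥(cmBorelTriple L 2 v).M | (t : ↥(unitaryGroupOfForm (conjLocal L (IsCMField.complexConj L) v) (cmLocalForm L 2 v))) ∈
              cmLocalIntegralLevel L 2 (Matrix.of fun i j : Fin 2 => if i.val + j.val + 1 = 2 then (1 : L) else 0) v} : ℝ) : ℂ) /
            (((ν₁.real (K₁ : Set ((cmDatum L 1 (Matrix.of fun i j : Fin 1 => if i.val + j.val + 1 = 1 then (1 : L) else 0)).Local v)) : ℝ) : ℂ) *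
              ((μT₂.real ((((𝓘₂.K n').comap (cmBorelTriple L 2 v).M.subtype : Subgroup ↥(cmBorelTriple L 2 v).M)) : Set ↥(cmBorelTriple L 2 v).M) : ℝ) : ℂ)),
          F0P3cStCharTSKappaRatio.hAG_of_closed_forms' _ _ _ _ _ _ hN, ?_,
          F0P3cStCharTSHcard.hrH L v w hw Ψ hΨ μT₂ ν₁ _ hC₂o hC₂c K₁ hK₁o hK₁c,
          F0P3cStCharTSHcard.hcard L v w hw Ψ hΨ μT μT₂ ν₁ Sn hSnc hSno b' _ hC₂o hC₂c K₁ hK₁o hK₁c F hcover hdisj⟩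
  exact F0P3cStCharTSKappaRatio.hAH_of_closed_forms F
    (fun u => (ν₂.real (𝓘₂.K n' : Set ↥(unitaryGroupOfForm (conjLocal L (IsCMField.complexConj L) v) (cmLocalForm L 2 v))) : ℂ) * ((R₂ u).card : ℂ) *
      (ν₁.real (K₁ : Set ((cmDatum L 1 (Matrix.of fun i j : Fin 1 => if i.val + j.val + 1 = 1 then (1 : L) else 0)).Local v)) : ℂ) *
      (((rootDeltaChar (cmBorelTriple L 2 v).P (Subgroup.inclusion (cmBorelTriple L 2 v).M_le
        ⟨(w₂ * (u.1 : ↥(unitaryGroupOfForm (conjLocal L (IsCMField.complexConj L) v) (cmLocalForm L 2 v))) * w₂⁻¹), (weylConj_mem_cmTorus_two L v w₂ hw₂ u.1)⟩)) : ℂˣ) : ℂ))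
    _ (fun u => ((R₂ u).card : ℂ))
    (fun u => (((rootDeltaChar (cmBorelTriple L 2 v).P (Subgroup.inclusion (cmBorelTriple L 2 v).M_le
        ⟨(w₂ * (u.1 : ↥(unitaryGroupOfForm (conjLocal L (IsCMField.complexConj L) v) (cmLocalForm L 2 v))) * w₂⁻¹), (weylConj_mem_cmTorus_two L v w₂ hw₂ u.1)⟩)) : ℂˣ) : ℂ))
    _ _ _ _ _ _ hNK (fun u _ => rfl) (fun u _ => rfl)
    (F0P3cStCharTSConstants.ofReal_measureReal_coe_subgroup_ne_zero ν₁ K₁ hK₁o hK₁c)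
    (F0P3cStCharTSConstants.ofReal_measureReal_coe_subgroup_ne_zero μT₂ _ hC₂o hC₂c)

end Summit.HodgeConjecture.HodgeConjecture.Cruxes.H413.F0P3cStCharTSValueRatios

end
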